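import Summits.QuantumFields.BalabanUV.Beta.EriceRemainderEnclosureHistoryAutonomyExistence

/-!
# EriceRemainderEnclosureHistoryAutonomyMonotone — (E41) MONOTONE CONCAVE MEMORY NEEDS NO SMALLNESS: if the functional is NON-DECREASING
# in the history (pointwise order on the box) and SUB-HOMOGENEOUS (`t·B(u) ≤ B(t·u)` for `0 < t < 1` — e.g. AFFINE with nonnegative weights of
# ANY total size and ANY range, or `b + Σ_k ψ_k(u_k)` with `ψ_k` concave non-decreasing, `ψ_k(0) ≥ 0`), then two box solutions of its flow
# with memory from one pin COINCIDE — for EVERY size of the memory: node U2's solution map is antitone and `(−½)`-sub-homogeneous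
# (`T(t·h) ≤ t^{−½}·T(h)`), and Guo's cone argument (`t₀ = inf_j min(h′_j∕h_j, h_j∕h′_j)` improves itself to `√t₀`) forces `t₀ = 1`.  With
# (E39) `exists_memFlow_zm`: `∃!` for every zeroth moment.  So (E38)'s threshold `3√3` prices the OSCILLATION of the memory ((E38c)'s tent is
# not monotone), not its size: in the moment table, monotone concave memory costs NOTHING at the AUTONOMY row beyond the floor

Cell `pub-balaban`, β-function sub-cell, BINDER row D4 «RemainderConst leaves for Bałaban's split» (`HOME/BINDER-OWNERS.md`; owner
lineage `b2b-balaban-beta-an4`; this file by co-owner #2 lineage `b2b-balaban-beta-d4-p2`, generation 40), β-FLOW TEAM duty (1),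
FREEZE (0) honoured (def-free; node U2's `MemFlow` ∕ `drive` ∕ `picard` ∕ `picard_eq_of_memFlow` ∕ `memFlow_sq_le` ∕ `invSq_eq_of_memFlow`,
(E38a)'s `le_inv_sqrt_of_le_inv_sq`, (E39)'s `exists_memFlow_zm` BY NAME).  Companion of (E38a–d), (E39), (E40); node U2's §8
`memFlow_unique_of_lagOne_monotone` (nearest-neighbour monotone memory, no smallness) is the range-one case WITHOUT sub-homogeneity —
whether monotonicity ALONE suffices at range ≥ 2 is NOT decided here.

HONEST FRAMING (page 1, verbatim and binding).  *"Discharging BetaPertH makes Bałaban's UV stability UNCONDITIONAL — a real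
constructive-QFT result; it is NOT the continuum limit and NOT the Clay problem."*  THIS FILE DISCHARGES NOTHING OF THE KIND.  Pure real
analysis (an ordered-cone argument) about an ABSTRACT functional with displayed monotonicity, sub-homogeneity and floor; which
monotonicity Bałaban's limit functional has in its arguments is NOT PRINTED and not asserted.  Row D4 class UNCHANGED (critical-path width 0;
instance 0∕1; D4 DISCHARGE NO DATE).  HONEST DEPENDENCY: continuum YM on T⁴ ⇐ BetaPertH ∧ nine spine estimates (0/9 proved); BetaPertH ⇐
(D1) ∧ (D4) ∧ CAP+tail; G-an2-4 gates asym, D1 and NE2/3/4.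

THE ARGUMENT ([folklore]; D. Guo's fixed point theorem for decreasing `(−α)`-convex operators on cones, `α = ½`).  `T h (m) =
(1∕gIR² + Σ_{l<m} B(h(l+1+·)))^{−1∕2}` is ANTITONE when `B` is non-decreasing, and `T(t·h) ≤ t^{−½}·T(h)` for `0 < t < 1` when
`B(t·u) ≥ t·B(u)` (the pin term only helps: `1∕gIR² ≥ t∕gIR²`).  Two box solutions `h, h′` are fixed points lying between the envelopes
`(1∕gIR² + m·B(γ,…))^{−1∕2} ≤ h_m ≤ (1∕gIR² + m·b)^{−1∕2}`, so `t₀ = inf_m min(h′_m∕h_m, h_m∕h′_m) ≥ b∕B(γ,…) > 0`, and `t₀ ≤ 1` (the pin).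
If `t₀ < 1`: `t₀·h ≤ h′` gives `h′ = T h′ ≤ T(t₀·h) ≤ t₀^{−½}·h`, i.e. `√t₀·h′ ≤ h`, and symmetrically `√t₀·h ≤ h′`; hence `t₀ ≥ √t₀ > t₀` —
absurd.  So `t₀ = 1`: `h ≤ h′ ≤ h`.

WHAT IS PROVED ([folklore]; 0 `def`, 0 sorry).  §1 `le_upper_of_monotone` (`B u ≤ B(γ,…)` on the box), `drive_le_of_monotone`,
`lower_envelope_of_monotone`, `upper_envelope`, `ratio_lower_bound` (`(b∕U)·h_m ≤ h′_m`), `drive_mono`, **`picard_antitone`**,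
`seqBox_smul`, `drive_smul_ge`, **`picard_smul_le`** (`T(t·h) ≤ T(h)∕√t`).  §2 **`memFlow_unique_of_monotone`** (monotone + sub-homogeneous +
floor ⟹ uniqueness, NO size condition), **`existsUnique_memFlow_of_monotone`** (+ any zeroth moment, via (E39)).  §3 the AFFINE class
`u ↦ b₀ + Σ_{k<K} L_k·u_k` (`b₀ > 0`, `L_k ≥ 0`): `affine_monotone`, `affine_subhomogeneous`, `affine_floor`, `affine_zerothMoment` (`M = Σ L_k`),
**`existsUnique_memFlow_affine`** (well-posed for EVERY `K` and EVERY nonnegative weights — total size `Σ L_k` unrestricted, against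
(E38c)'s non-monotone tent failing above `3√3·b∕γ`).
-/

noncomputable section
open Filter Topology Finset

namespace Summit.QuantumFields.BalabanUV.Beta.EriceRemainderEnclosureHistoryAutonomyMonotone

open Literature.MathematicalPhysics.QuantumFieldTheory.Balaban1983to89
open Literature.MathematicalPhysics.QuantumFieldTheory.Balaban1983to89.T4BetaStationary
open Literature.MathematicalPhysics.QuantumFieldTheory.Balaban1983to89.T4BetaFlowWellPosed
open Summit.QuantumFields.BalabanUV.Beta.EriceRemainderEnclosureHistoryAutonomyThreshold
open Summit.QuantumFields.BalabanUV.Beta.EriceRemainderEnclosureHistoryAutonomyExistence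

variable {B : (ℕ → ℝ) → ℝ} {M γ b gIR t : ℝ} {h h' : ℕ → ℝ}

/-! ## §1 Envelopes under monotonicity; the solution map is antitone and `(−½)`-sub-homogeneous -/

/-- A non-decreasing functional is bounded on the box by its value at the constant history `γ`. [folklore] -/
theorem le_upper_of_monotone (hmono : ∀ u v : ℕ → ℝ, SeqBox γ u → SeqBox γ v → (∀ j, u j ≤ v j) → B u ≤ B v)
    (hγ : 0 < γ) {u : ℕ → ℝ} (hu : SeqBox γ u) : B u ≤ B (fun _ => γ) :=
  hmono u _ hu (seqBox_const hγ) fun j => (hu j).2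

/-- Driving sums under monotonicity: `drive B h m ≤ m·B(γ,…)`. [folklore] -/
theorem drive_le_of_monotone (hmono : ∀ u v : ℕ → ℝ, SeqBox γ u → SeqBox γ v → (∀ j, u j ≤ v j) → B u ≤ B v)
    (hγ : 0 < γ) (hh : SeqBox γ h) : ∀ m : ℕ, drive B h m ≤ (m : ℝ) * B (fun _ => γ) := by
  intro m
  induction m with
  | zero => simp
  | succ m ih =>
    rw [drive_succ, Nat.cast_succ, add_mul, one_mul]
    exact add_le_add ih (le_upper_of_monotone hmono hγ (seqBox_shift hh (m + 1)))

/-- LOWER ENVELOPE of a box solution: `1∕√(1∕gIR² + m·B(γ,…)) ≤ h m`. [folklore] -/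
theorem lower_envelope_of_monotone (hmono : ∀ u v : ℕ → ℝ, SeqBox γ u → SeqBox γ v → (∀ j, u j ≤ v j) → B u ≤ B v)
    (hγ : 0 < γ) (hh : SeqBox γ h) (hf : MemFlow B gIR h) (m : ℕ) :
    1 / Real.sqrt (1 / gIR ^ 2 + (m : ℝ) * B (fun _ => γ)) ≤ h m := by
  have hS : 1 / h m ^ 2 ≤ 1 / gIR ^ 2 + (m : ℝ) * B (fun _ => γ) := by
    rw [invSq_eq_of_memFlow hf m]; exact add_le_add le_rfl (drive_le_of_monotone hmono hγ hh m)
  have := one_div_sqrt_anti (by have := (hh m).1; positivity) hS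
  rwa [one_div_sqrt_one_div_sq (hh m).1] at this

/-- UPPER ENVELOPE of a box solution with floor `b`: `h m ≤ 1∕√(1∕gIR² + m·b)`. [folklore] -/
theorem upper_envelope (hb : 0 < b) (hgIR : 0 < gIR) (hlo : ∀ u, SeqBox γ u → b ≤ B u) (hh : SeqBox γ h)
    (hf : MemFlow B gIR h) (m : ℕ) : h m ≤ 1 / Real.sqrt (1 / gIR ^ 2 + (m : ℝ) * b) := by
  have hP0 : 0 < 1 / gIR ^ 2 + (m : ℝ) * b := by
    have : (0 : ℝ) ≤ (m : ℝ) * b := mul_nonneg (Nat.cast_nonneg m) hb.le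
    positivity
  have h1 := memFlow_sq_le hlo hb hgIR hh hf m
  have h2 : 1 / gIR ^ 2 + (m : ℝ) * b ≤ 1 / h m ^ 2 := by
    have := one_div_le_one_div_of_le (pow_pos (hh m).1 2) h1
    rwa [one_div_one_div] at this
  exact le_inv_sqrt_of_le_inv_sq (hh m).1 hP0 h2

/-- **THE TWO SOLUTIONS ARE COMPARABLE UP TO `b∕B(γ,…)`**: `(b∕U)·h m ≤ h′ m`, `U = B(γ,…)`, at every scale. [folklore] -/
theorem ratio_lower_bound (hmono : ∀ u v : ℕ → ℝ, SeqBox γ u → SeqBox γ v → (∀ j, u j ≤ v j) → B u ≤ B v)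
    (hb : 0 < b) (hgIR : 0 < gIR) (hgIRγ : gIR ≤ γ) (hlo : ∀ u, SeqBox γ u → b ≤ B u)
    (hh : SeqBox γ h) (hh' : SeqBox γ h') (hf : MemFlow B gIR h) (hf' : MemFlow B gIR h') (m : ℕ) :
    b / B (fun _ => γ) * h m ≤ h' m := by
  have hγ : 0 < γ := lt_of_lt_of_le hgIR hgIRγ
  set U := B (fun _ => γ) with hU
  have hbU : b ≤ U := hlo _ (seqBox_const hγ)
  have hU0 : 0 < U := hb.trans_le hbU
  have hr0 : 0 < b / U := div_pos hb hU0
  have hr1 : b / U ≤ 1 := (div_le_one hU0).2 hbU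
  have hhi := upper_envelope hb hgIR hlo hh hf m
  have hlo' := lower_envelope_of_monotone (gIR := gIR) hmono hγ hh' hf' m
  have hmb : (0 : ℝ) ≤ (m : ℝ) * b := mul_nonneg (Nat.cast_nonneg m) hb.le
  have hP : 0 < 1 / gIR ^ 2 + (m : ℝ) * b := by positivity
  have hQ : 0 < 1 / gIR ^ 2 + (m : ℝ) * U := by positivity
  -- compare the squares: (b/U)²·(1/P) ≤ 1/Q
  have eP : (1 / Real.sqrt (1 / gIR ^ 2 + (m : ℝ) * b)) ^ 2 = 1 / (1 / gIR ^ 2 + (m : ℝ) * b) := by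
    rw [div_pow, one_pow, Real.sq_sqrt hP.le]
  have eQ : (1 / Real.sqrt (1 / gIR ^ 2 + (m : ℝ) * U)) ^ 2 = 1 / (1 / gIR ^ 2 + (m : ℝ) * U) := by
    rw [div_pow, one_pow, Real.sq_sqrt hQ.le]
  have key : (b / U) ^ 2 * (1 / gIR ^ 2 + (m : ℝ) * U) ≤ 1 / gIR ^ 2 + (m : ℝ) * b := by
    have hr2 : (b / U) ^ 2 ≤ 1 := by nlinarith
    have e1 : (b / U) ^ 2 * ((m : ℝ) * U) = (m : ℝ) * b * (b / U) := by
      field_simp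
    calc (b / U) ^ 2 * (1 / gIR ^ 2 + (m : ℝ) * U) = (b / U) ^ 2 * (1 / gIR ^ 2) + (b / U) ^ 2 * ((m : ℝ) * U) := by ring
      _ ≤ 1 * (1 / gIR ^ 2) + (m : ℝ) * b * 1 :=
          add_le_add (mul_le_mul_of_nonneg_right hr2 (by positivity)) (by rw [e1]; exact mul_le_mul_of_nonneg_left hr1 hmb)
      _ = 1 / gIR ^ 2 + (m : ℝ) * b := by ring
  have hsq : (b / U * (1 / Real.sqrt (1 / gIR ^ 2 + (m : ℝ) * b))) ^ 2
      ≤ (1 / Real.sqrt (1 / gIR ^ 2 + (m : ℝ) * U)) ^ 2 := by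
    rw [mul_pow, eP, eQ, mul_one_div, div_le_div_iff₀ hP hQ, one_mul]
    exact key
  have hle : b / U * (1 / Real.sqrt (1 / gIR ^ 2 + (m : ℝ) * b)) ≤ 1 / Real.sqrt (1 / gIR ^ 2 + (m : ℝ) * U) :=
    (pow_le_pow_iff_left₀ (by positivity) (by positivity) two_ne_zero).1 hsq
  calc b / U * h m ≤ b / U * (1 / Real.sqrt (1 / gIR ^ 2 + (m : ℝ) * b)) := mul_le_mul_of_nonneg_left hhi hr0.le
    _ ≤ 1 / Real.sqrt (1 / gIR ^ 2 + (m : ℝ) * U) := hle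
    _ ≤ h' m := hlo'

/-- Monotone functional ⟹ monotone driving sums. [folklore] -/
theorem drive_mono (hmono : ∀ u v : ℕ → ℝ, SeqBox γ u → SeqBox γ v → (∀ j, u j ≤ v j) → B u ≤ B v)
    (hh : SeqBox γ h) (hh' : SeqBox γ h') (hle : ∀ j, h j ≤ h' j) (m : ℕ) : drive B h m ≤ drive B h' m :=
  Finset.sum_le_sum fun l _ => hmono _ _ (seqBox_shift hh (l + 1)) (seqBox_shift hh' (l + 1)) fun j => hle (l + 1 + j)

/-- **THE SOLUTION MAP IS ANTITONE** for a non-decreasing functional with floor. [folklore] -/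
theorem picard_antitone (hmono : ∀ u v : ℕ → ℝ, SeqBox γ u → SeqBox γ v → (∀ j, u j ≤ v j) → B u ≤ B v)
    (hgIR : 0 < gIR) (hb : 0 < b) (hlo : ∀ u, SeqBox γ u → b ≤ B u) (hh : SeqBox γ h) (hh' : SeqBox γ h')
    (hle : ∀ j, h j ≤ h' j) (m : ℕ) : picard B gIR h' m ≤ picard B gIR h m :=
  one_div_sqrt_anti (base_pos hgIR hb hlo hh m) (add_le_add le_rfl (drive_mono hmono hh hh' hle m))

/-- Scaling by `t ∈ ]0,1]` keeps a history in the box. [folklore] -/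
theorem seqBox_smul (hh : SeqBox γ h) (ht0 : 0 < t) (ht1 : t ≤ 1) : SeqBox γ (fun j => t * h j) := fun j =>
  ⟨mul_pos ht0 (hh j).1, (mul_le_of_le_one_left (hh j).1.le ht1).trans (hh j).2⟩

/-- Sub-homogeneous functional ⟹ `t·drive B h ≤ drive B (t·h)`. [folklore] -/
theorem drive_smul_ge (hsub : ∀ u : ℕ → ℝ, SeqBox γ u → ∀ t : ℝ, 0 < t → t < 1 → t * B u ≤ B (fun j => t * u j))
    (hh : SeqBox γ h) (ht0 : 0 < t) (ht1 : t < 1) (m : ℕ) : t * drive B h m ≤ drive B (fun j => t * h j) m := by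
  unfold drive
  rw [Finset.mul_sum]
  exact Finset.sum_le_sum fun l _ => hsub _ (seqBox_shift hh (l + 1)) t ht0 ht1

/-- **THE SOLUTION MAP IS `(−½)`-SUB-HOMOGENEOUS**: `picard B gIR (t·h) m ≤ picard B gIR h m ∕ √t` for `0 < t < 1`. [folklore] -/
theorem picard_smul_le (hsub : ∀ u : ℕ → ℝ, SeqBox γ u → ∀ t : ℝ, 0 < t → t < 1 → t * B u ≤ B (fun j => t * u j))
    (hgIR : 0 < gIR) (hb : 0 < b) (hlo : ∀ u, SeqBox γ u → b ≤ B u) (hh : SeqBox γ h) (ht0 : 0 < t) (ht1 : t < 1)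
    (m : ℕ) : picard B gIR (fun j => t * h j) m ≤ picard B gIR h m / Real.sqrt t := by
  have hbase := base_pos hgIR hb hlo hh m
  have h1 : t * (1 / gIR ^ 2 + drive B h m) ≤ 1 / gIR ^ 2 + drive B (fun j => t * h j) m := by
    rw [mul_add]
    exact add_le_add (by nlinarith [one_div_pos.2 (pow_pos hgIR 2)]) (drive_smul_ge hsub hh ht0 ht1 m)
  unfold picard
  calc 1 / Real.sqrt (1 / gIR ^ 2 + drive B (fun j => t * h j) m)
      ≤ 1 / Real.sqrt (t * (1 / gIR ^ 2 + drive B h m)) := one_div_sqrt_anti (by positivity) h1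
    _ = 1 / Real.sqrt (1 / gIR ^ 2 + drive B h m) / Real.sqrt t := by
        rw [Real.sqrt_mul ht0.le, div_div, mul_comm]

/-! ## §2 Uniqueness without smallness for monotone sub-homogeneous memory -/

/-- **MONOTONE CONCAVE MEMORY NEEDS NO SMALLNESS.**  `B` non-decreasing in the history and sub-homogeneous (`t·B u ≤ B(t·u)`, `0 < t < 1`)
on the box ]0,γ]^ℕ, with floor `b > 0`; pin `gIR ∈ ]0,γ]`.  Two box solutions of the flow with memory from `gIR` COINCIDE — whatever the
size and range of the memory (Guo's cone argument: `t₀ = inf_m min(h′_m∕h_m, h_m∕h′_m) ∈ [b∕B(γ,…), 1]` improves to `√t₀`). [folklore] -/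
theorem memFlow_unique_of_monotone
    (hmono : ∀ u v : ℕ → ℝ, SeqBox γ u → SeqBox γ v → (∀ j, u j ≤ v j) → B u ≤ B v)
    (hsub : ∀ u : ℕ → ℝ, SeqBox γ u → ∀ t : ℝ, 0 < t → t < 1 → t * B u ≤ B (fun j => t * u j))
    (hgIR : 0 < gIR) (hgIRγ : gIR ≤ γ) (hb : 0 < b) (hlo : ∀ u, SeqBox γ u → b ≤ B u)
    (hh : SeqBox γ h) (hh' : SeqBox γ h') (hf : MemFlow B gIR h) (hf' : MemFlow B gIR h') : h = h' := by
  have hγ : 0 < γ := lt_of_lt_of_le hgIR hgIRγ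
  set U := B (fun _ => γ) with hU
  have hbU : b ≤ U := hlo _ (seqBox_const hγ)
  have hU0 : 0 < U := hb.trans_le hbU
  set r : ℝ := b / U with hr
  have hr0 : 0 < r := div_pos hb hU0
  -- the ratio functional and its infimum
  set ρ : ℕ → ℝ := fun m => min (h' m / h m) (h m / h' m) with hρ
  have hρr : ∀ m, r ≤ ρ m := fun m => by
    refine le_min ?_ ?_
    · rw [le_div_iff₀ (hh m).1]; exact ratio_lower_bound hmono hb hgIR hgIRγ hlo hh hh' hf hf' m
    · rw [le_div_iff₀ (hh' m).1]; exact ratio_lower_bound hmono hb hgIR hgIRγ hlo hh' hh hf' hf m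
  have hbdd : BddBelow (Set.range ρ) := ⟨r, by rintro _ ⟨m, rfl⟩; exact hρr m⟩
  set t₀ : ℝ := ⨅ m, ρ m with ht₀
  have ht₀r : r ≤ t₀ := le_ciInf hρr
  have ht₀0 : 0 < t₀ := hr0.trans_le ht₀r
  have ht₀le : ∀ m, t₀ ≤ ρ m := fun m => ciInf_le hbdd m
  have ht₀1 : t₀ ≤ 1 := by
    have := ht₀le 0
    have e : ρ 0 = 1 := by simp [hρ, hf.1, hf'.1, hgIR.ne']
    linarith
  -- `t₀·h ≤ h′` and `t₀·h′ ≤ h`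
  have hA : ∀ m, t₀ * h m ≤ h' m := fun m => by
    rw [← le_div_iff₀ (hh m).1]; exact (ht₀le m).trans (min_le_left _ _)
  have hA' : ∀ m, t₀ * h' m ≤ h m := fun m => by
    rw [← le_div_iff₀ (hh' m).1]; exact (ht₀le m).trans (min_le_right _ _)
  -- either `t₀ = 1` (done) or the cone argument improves `t₀` to `√t₀ > t₀`
  rcases eq_or_lt_of_le ht₀1 with h1 | hlt
  · funext m
    have a := hA m; have a' := hA' m
    rw [h1, one_mul] at a a'
    exact le_antisymm a a'
  · exfalso
    have hfix := picard_eq_of_memFlow hf (fun m => (hh m).1)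
    have hfix' := picard_eq_of_memFlow hf' (fun m => (hh' m).1)
    have hst : Real.sqrt t₀ ≤ t₀ := by
      refine le_ciInf fun m => le_min ?_ ?_
      · -- `√t₀ · h m ≤ h′ m`... from `h = T h ≤ T(t₀ h′) ≤ T h′ / √t₀ = h′/√t₀`
        have step : h m ≤ h' m / Real.sqrt t₀ := by
          calc h m = picard B gIR h m := by rw [hfix]
            _ ≤ picard B gIR (fun j => t₀ * h' j) m :=
                picard_antitone hmono hgIR hb hlo (seqBox_smul hh' ht₀0 ht₀1) hh hA' m
            _ ≤ picard B gIR h' m / Real.sqrt t₀ := picard_smul_le hsub hgIR hb hlo hh' ht₀0 hlt m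
            _ = h' m / Real.sqrt t₀ := by rw [hfix']
        rw [le_div_iff₀ (hh m).1]
        rwa [le_div_iff₀ (Real.sqrt_pos.2 ht₀0), mul_comm] at step
      · have step : h' m ≤ h m / Real.sqrt t₀ := by
          calc h' m = picard B gIR h' m := by rw [hfix']
            _ ≤ picard B gIR (fun j => t₀ * h j) m :=
                picard_antitone hmono hgIR hb hlo (seqBox_smul hh ht₀0 ht₀1) hh' hA m
            _ ≤ picard B gIR h m / Real.sqrt t₀ := picard_smul_le hsub hgIR hb hlo hh ht₀0 hlt m
            _ = h m / Real.sqrt t₀ := by rw [hfix]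
        rw [le_div_iff₀ (hh' m).1]
        rwa [le_div_iff₀ (Real.sqrt_pos.2 ht₀0), mul_comm] at step
    -- but `t₀ < √t₀` for `0 < t₀ < 1`
    have hlt' : t₀ < Real.sqrt t₀ := by
      have h2 : t₀ * t₀ < t₀ * 1 := mul_lt_mul_of_pos_left hlt ht₀0
      rw [mul_one] at h2
      calc t₀ = Real.sqrt (t₀ * t₀) := (Real.sqrt_mul_self ht₀0.le).symm
        _ < Real.sqrt t₀ := Real.sqrt_lt_sqrt (by positivity) h2
    linarith

/-- **WELL-POSEDNESS FOR MONOTONE CONCAVE MEMORY OF ANY SIZE**: with, in addition, a zeroth moment `M ≥ 0` (ANY size — used for existence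
only, (E39) `exists_memFlow_zm`), there is EXACTLY one box solution from every pin. [folklore] -/
theorem existsUnique_memFlow_of_monotone
    (hmono : ∀ u v : ℕ → ℝ, SeqBox γ u → SeqBox γ v → (∀ j, u j ≤ v j) → B u ≤ B v)
    (hsub : ∀ u : ℕ → ℝ, SeqBox γ u → ∀ t : ℝ, 0 < t → t < 1 → t * B u ≤ B (fun j => t * u j))
    (hB : ∀ u u' : ℕ → ℝ, SeqBox γ u → SeqBox γ u' → ∀ D : ℝ, (∀ j, |u j - u' j| ≤ D) → |B u - B u'| ≤ M * D)
    (hM : 0 ≤ M) (hgIR : 0 < gIR) (hgIRγ : gIR ≤ γ) (hb : 0 < b) (hlo : ∀ u, SeqBox γ u → b ≤ B u) :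
    ∃! h : ℕ → ℝ, SeqBox γ h ∧ MemFlow B gIR h := by
  obtain ⟨h, hh, hf⟩ := exists_memFlow_zm hB hM hgIR hgIRγ hb hlo
  exact ⟨h, ⟨hh, hf⟩, fun h' hh' => memFlow_unique_of_monotone hmono hsub hgIR hgIRγ hb hlo hh'.1 hh hh'.2 hf⟩

/-! ## §3 The affine class: nonnegative weights of any total size and any range -/

variable {b₀ : ℝ} {L : ℕ → ℝ} {K : ℕ}

/-- The affine functional `u ↦ b₀ + Σ_{k<K} L_k·u_k` with `L ≥ 0` is non-decreasing. [folklore] -/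
theorem affine_monotone (hL : ∀ k, 0 ≤ L k) :
    ∀ u v : ℕ → ℝ, SeqBox γ u → SeqBox γ v → (∀ j, u j ≤ v j) →
      b₀ + ∑ k ∈ range K, L k * u k ≤ b₀ + ∑ k ∈ range K, L k * v k :=
  fun _ _ _ _ hle => add_le_add le_rfl (Finset.sum_le_sum fun k _ => mul_le_mul_of_nonneg_left (hle k) (hL k))

/-- … sub-homogeneous when `b₀ ≥ 0`. [folklore] -/
theorem affine_subhomogeneous (hb₀ : 0 ≤ b₀) :
    ∀ u : ℕ → ℝ, SeqBox γ u → ∀ t : ℝ, 0 < t → t < 1 →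
      t * (b₀ + ∑ k ∈ range K, L k * u k) ≤ b₀ + ∑ k ∈ range K, L k * (t * u k) := by
  intro u _ t ht0 ht1
  rw [mul_add, Finset.mul_sum]
  have h1 : t * b₀ ≤ b₀ := mul_le_of_le_one_left hb₀ ht1.le
  have h2 : ∑ k ∈ range K, t * (L k * u k) = ∑ k ∈ range K, L k * (t * u k) :=
    Finset.sum_congr rfl fun k _ => by ring
  linarith

/-- … has floor `b₀`. [folklore] -/
theorem affine_floor (hL : ∀ k, 0 ≤ L k) : ∀ u : ℕ → ℝ, SeqBox γ u → b₀ ≤ b₀ + ∑ k ∈ range K, L k * u k :=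
  fun _ hu => le_add_of_nonneg_right (Finset.sum_nonneg fun k _ => mul_nonneg (hL k) (hu k).1.le)

/-- … and zeroth moment `Σ_{k<K} L_k`. [folklore] -/
theorem affine_zerothMoment (hL : ∀ k, 0 ≤ L k) :
    ∀ u u' : ℕ → ℝ, SeqBox γ u → SeqBox γ u' → ∀ D : ℝ, (∀ j, |u j - u' j| ≤ D) →
      |(b₀ + ∑ k ∈ range K, L k * u k) - (b₀ + ∑ k ∈ range K, L k * u' k)| ≤ (∑ k ∈ range K, L k) * D := by
  intro u u' _ _ D hD
  rw [add_sub_add_left_eq_sub, ← Finset.sum_sub_distrib, Finset.sum_mul]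
  refine (Finset.abs_sum_le_sum_abs _ _).trans (Finset.sum_le_sum fun k _ => ?_)
  rw [← mul_sub, abs_mul, abs_of_nonneg (hL k)]
  exact mul_le_mul_of_nonneg_left (hD k) (hL k)

/-- **AFFINE MONOTONE MEMORY OF ANY SIZE AND RANGE IS WELL-POSED**: `u ↦ b₀ + Σ_{k<K} L_k·u_k` (`b₀ > 0`, `L_k ≥ 0`) has exactly one box
solution from every pin `gIR ∈ ]0,γ]` — for EVERY range `K` and EVERY total weight `Σ L_k` (against (E38c): the non-monotone tent fails
above the ratio `3√3`). [folklore] -/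
theorem existsUnique_memFlow_affine (hb₀ : 0 < b₀) (hL : ∀ k, 0 ≤ L k) (hgIR : 0 < gIR) (hgIRγ : gIR ≤ γ) :
    ∃! h : ℕ → ℝ, SeqBox γ h ∧ MemFlow (fun u => b₀ + ∑ k ∈ range K, L k * u k) gIR h :=
  existsUnique_memFlow_of_monotone (affine_monotone hL) (affine_subhomogeneous hb₀.le) (affine_zerothMoment hL)
    (Finset.sum_nonneg fun k _ => hL k) hgIR hgIRγ hb₀ (affine_floor hL)

end Summit.QuantumFields.BalabanUV.Beta.EriceRemainderEnclosureHistoryAutonomyMonotone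

end
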